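import Summits.KontsevichZagierPeriods.KontsevichZagierPeriods.Theorems.HurwitzMicroSectorsNormalFormPrincipleLevelOne
import Summits.KontsevichZagierPeriods.KontsevichZagierPeriods.Theorems.HurwitzMicroSectorsNormalFormPrincipleSlabASubPtK20
import Summits.KontsevichZagierPeriods.KontsevichZagierPeriods.Theorems.HurwitzMicroSectorsNormalFormPrincipleAlgCarriers
import Summits.KontsevichZagierPeriods.KontsevichZagierPeriods.Theorems.HurwitzMicroSectorsNormalFormPrincipleM2FiveZetaTwo

/-!
# `NormalFormPrinciple` (stmt-KontsevichZagierPeriods-3869), line `SketchIdeator1` — leaf `stub_boxRigidity`: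
# weight two, level `K`, off the diagonal: the power substitution `(X,Y) ↦ (X^{m₁}, Y^{m₂})` (rule 2)

Pure proof file (`--supports` the crux). Registered sub-goal `power_substitution` of the layer
"Conjecture 1 for the boxes `[(0,1)², c x^a y^b/(1 − x^{k₁} y^{k₂})]` off resonance" (lead file
`…LevelK`): the box `[(0,1)², c x^a y^b/(1 − x^{k₁} y^{k₂})]` is the push-forward, by ONE change of
variables, of `[(0,1)², c m₁m₂ X^{(a+1)m₁−1} Y^{(b+1)m₂−1}/(1 − X^{k₁m₁} Y^{k₂m₂})]` (`m₁, m₂ ≥ 1`).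

The chart `Φ(X,Y) = (X^{m₁}, Y^{m₂})` is a `ℚ`-polynomial (hence `ℚ`-semialgebraic) map,
differentiable with derivative `diag(m₁ X^{m₁−1}, m₂ Y^{m₂−1})` of determinant
`m₁m₂ X^{m₁−1} Y^{m₂−1} > 0` on the open box, injective on the box (`t ↦ t^m` is injective on the
positive reals) and ONTO it (inverse `(u^{1/m₁}, v^{1/m₂})`); we record this coordinatewise power
chart once in every dimension `n` with an arbitrary exponent vector (`lk_exists_coordPowChart`).
The pull-back identity
`c (X^{m₁})^a (Y^{m₂})^b/(1 − (X^{m₁})^{k₁} (Y^{m₂})^{k₂}) · m₁m₂ X^{m₁−1} Y^{m₂−1}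
  = c m₁m₂ X^{(a+1)m₁−1} Y^{(b+1)m₂−1}/(1 − X^{k₁m₁} Y^{k₂m₂})`
holds identically (`lk_pow_pullback`; `(a+1)m₁ − 1 = a m₁ + (m₁ − 1)` is a genuine natural number as
`m₁ ≥ 1`). Hence `[N'] − [N] ∈ KZ.changeOfVariablesRel ⊆ KZ.relations` (source = the pull-back `N'`,
image = `N`), and `[N] − [N']` is its negative. Rule (2) asks for the integrand identity on the
domain only, so the `EqOn` hypotheses suffice; the algebraicity of `c` and the positivity of
`k₁, k₂` are not used (both representations being given). Pattern of
`KZ.exists_dirichletPolarChart` (`KZDirichletCharts.lean`) and of `BoxIntegral.coordPow`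
(`BoxCoordinatePowerMap.lean`).

References: M. Kontsevich, D. Zagier, *Periods* (2001), §1.2 rule (2). No new definitions.
-/

noncomputable section

open MeasureTheory Set
open Literature.NumberTheory.Transcendental Literature.NumberTheory.Transcendental.KZ
open Literature.ModelTheory.ExponentialFields (IsSemialgebraic)

namespace Summit.KontsevichZagierPeriods.HurwitzMicroSectors.NormalFormPrinciple.PiBox.LevelK

/-- **The pull-back identity** of the power chart `(X,Y) ↦ (X^{m₁}, Y^{m₂})` (Jacobian
`m₁m₂ X^{m₁−1} Y^{m₂−1}` included), `m₁, m₂ ≥ 1`: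
`c m₁m₂ X^{(a+1)m₁−1} Y^{(b+1)m₂−1}/(1 − X^{k₁m₁} Y^{k₂m₂})
  = c (X^{m₁})^a (Y^{m₂})^b/(1 − (X^{m₁})^{k₁} (Y^{m₂})^{k₂}) · (m₁ X^{m₁−1} · (m₂ Y^{m₂−1}))`,
identically in `X, Y`. [folklore] -/
theorem lk_pow_pullback (c : ℝ) (a b : ℕ) {m₁ m₂ : ℕ} (hm₁ : 0 < m₁) (hm₂ : 0 < m₂) (k₁ k₂ : ℕ)
    (x y : ℝ) :
    c * ((m₁ * m₂ : ℕ) : ℝ) * (x ^ ((a + 1) * m₁ - 1) * y ^ ((b + 1) * m₂ - 1)) /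
        (1 - x ^ (k₁ * m₁) * y ^ (k₂ * m₂)) =
      c * ((x ^ m₁) ^ a * (y ^ m₂) ^ b) / (1 - (x ^ m₁) ^ k₁ * (y ^ m₂) ^ k₂) *
        ((m₁ : ℝ) * x ^ (m₁ - 1) * ((m₂ : ℝ) * y ^ (m₂ - 1))) := by
  have e₁ : (a + 1) * m₁ - 1 = a * m₁ + (m₁ - 1) := by rw [add_one_mul]; omega
  have e₂ : (b + 1) * m₂ - 1 = b * m₂ + (m₂ - 1) := by rw [add_one_mul]; omega
  rw [e₁, e₂]
  push_cast
  ring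

/-- **The coordinatewise power chart `Φ(x) = (xᵢ^{mᵢ})ᵢ`** of the open unit box `(0,1)ⁿ` onto
itself, for an exponent vector `m` with `mᵢ ≥ 1`: a `ℚ`-polynomial (hence `ℚ`-semialgebraic) map,
differentiable with derivative `diag(mᵢ xᵢ^{mᵢ−1})` and `|det DΦ| = ∏ᵢ mᵢ xᵢ^{mᵢ−1}` on the box,
injective on the box (powers of positive reals) and ONTO the box (inverse `(yᵢ^{1/mᵢ})ᵢ`).
[folklore] -/
theorem lk_exists_coordPowChart {n : ℕ} (m : Fin n → ℕ) (hm : ∀ i, m i ≠ 0) :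
    ∃ (Φ : (Fin n → ℝ) → (Fin n → ℝ)) (Φ' : (Fin n → ℝ) → (Fin n → ℝ) →L[ℝ] (Fin n → ℝ)),
      (∀ z i, Φ z i = z i ^ m i) ∧
      IsSemialgebraicMapOn ℚ {x : Fin n → ℝ | ∀ i, x i ∈ Set.Ioo (0:ℝ) 1} Φ ∧
      (∀ z, HasFDerivAt Φ (Φ' z) z) ∧
      Set.InjOn Φ {x : Fin n → ℝ | ∀ i, x i ∈ Set.Ioo (0:ℝ) 1} ∧
      Φ '' {x : Fin n → ℝ | ∀ i, x i ∈ Set.Ioo (0:ℝ) 1} =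
        {x : Fin n → ℝ | ∀ i, x i ∈ Set.Ioo (0:ℝ) 1} ∧
      (∀ z ∈ {x : Fin n → ℝ | ∀ i, x i ∈ Set.Ioo (0:ℝ) 1},
        |(Φ' z).det| = ∏ i, (m i : ℝ) * z i ^ (m i - 1)) := by
  refine ⟨fun z i => z i ^ m i,
    fun z => ContinuousLinearMap.pi fun i =>
      ((m i : ℝ) * z i ^ (m i - 1)) • ContinuousLinearMap.proj (R := ℝ) (φ := fun _ : Fin n => ℝ) i,
    fun z i => rfl, ?_, fun z => ?_, ?_, ?_, fun z hz => ?_⟩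
  · -- a `ℚ`-polynomial map is `ℚ`-semialgebraic
    convert isSemialgebraicMapOn_aeval (isSemialgebraic_box n)
      (fun j => (MvPolynomial.X j ^ m j : MvPolynomial (Fin n) ℚ)) using 2 with z
    funext j
    simp
  · -- the derivative, coordinatewise `d/dt t^m = m t^{m-1}`
    refine hasFDerivAt_pi.mpr fun i => ?_
    have h := ((hasDerivAt_pow (m i) (z i)).hasFDerivAt).comp z (hasFDerivAt_apply (𝕜 := ℝ) i z)
    refine h.congr_fderiv ?_
    ext v
    simp [mul_comm]
  · -- injective on the positive box
    intro x hx y hy hxy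
    funext i
    have h := congr_fun hxy i
    exact (pow_left_inj₀ (hx i).1.le (hy i).1.le (hm i)).mp h
  · -- onto the box
    refine subset_antisymm ?_ fun y hy => ?_
    · rintro _ ⟨x, hx, rfl⟩ i
      exact ⟨pow_pos (hx i).1 _, pow_lt_one₀ (hx i).1.le (hx i).2 (hm i)⟩
    · refine ⟨fun i => y i ^ ((m i : ℝ)⁻¹), fun i => ⟨?_, ?_⟩, ?_⟩
      · exact Real.rpow_pos_of_pos (hy i).1 _
      · exact Real.rpow_lt_one (hy i).1.le (hy i).2
          (inv_pos.2 (Nat.cast_pos.2 (Nat.pos_of_ne_zero (hm i))))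
      · funext i
        exact Real.rpow_inv_natCast_pow (hy i).1.le (hm i)
  · -- the Jacobian: determinant of the diagonal derivative, positive on the box
    have hcoe : ((ContinuousLinearMap.pi fun i =>
        ((m i : ℝ) * z i ^ (m i - 1)) • ContinuousLinearMap.proj (R := ℝ) (φ := fun _ : Fin n => ℝ) i
          : (Fin n → ℝ) →L[ℝ] (Fin n → ℝ)) : (Fin n → ℝ) →ₗ[ℝ] (Fin n → ℝ)) =
        Matrix.toLin' (Matrix.diagonal fun i => (m i : ℝ) * z i ^ (m i - 1)) := by
      refine LinearMap.ext fun v => funext fun i => ?_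
      rw [ContinuousLinearMap.coe_coe, Matrix.toLin'_apply, Matrix.mulVec_diagonal]
      simp
    rw [ContinuousLinearMap.det, hcoe, LinearMap.det_toLin', Matrix.det_diagonal]
    exact abs_of_pos (Finset.prod_pos fun i _ =>
      mul_pos (Nat.cast_pos.2 (Nat.pos_of_ne_zero (hm i))) (pow_pos (hz i).1 _))

/-- **Stub K5 (the power substitution `(X,Y) ↦ (X^{m₁}, Y^{m₂})`, rule 2):**
`[(0,1)², c x^a y^b/(1 − x^{k₁}y^{k₂})]` is the push-forward of
`[(0,1)², c m₁m₂ X^{(a+1)m₁−1} Y^{(b+1)m₂−1}/(1 − X^{k₁m₁} Y^{k₂m₂})]`. One raw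
change-of-variables move `KZ.changeOfVariablesRel` with source the pull-back `N'`, chart
`Φ(X,Y) = (X^{m₁}, Y^{m₂})` (`lk_exists_coordPowChart` with exponent vector `(m₁, m₂)`) and image `N`:
the identity `N'.integrand = (N.integrand ∘ Φ) · |det DΦ|` on the box is `lk_pow_pullback`; then
`[N] − [N'] = −([N'] − [N])`. (The hypotheses that `c` is algebraic and `k₁, k₂ ≥ 1` are not needed:
both representations are given.) [cite: KontsevichZagier2001, §1.2 rule (2)] -/
theorem power_substitution (m₁ m₂ : ℕ) (hm₁ : 0 < m₁) (hm₂ : 0 < m₂) (k₁ k₂ : ℕ) (hk₁ : 0 < k₁)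
    (hk₂ : 0 < k₂) (c : ℝ) (hc : IsAlgebraic ℚ c) (a b : ℕ) (N N' : IntegralRep 2)
    (hNd : N.domain = {x | ∀ i, x i ∈ Set.Ioo (0:ℝ) 1})
    (hNi : EqOn N.integrand (fun x => c * (x 0 ^ a * x 1 ^ b) / (1 - x 0 ^ k₁ * x 1 ^ k₂)) N.domain)
    (hN'd : N'.domain = {x | ∀ i, x i ∈ Set.Ioo (0:ℝ) 1})
    (hN'i : EqOn N'.integrand (fun x => c * ((m₁ * m₂ : ℕ) : ℝ) *
      (x 0 ^ ((a + 1) * m₁ - 1) * x 1 ^ ((b + 1) * m₂ - 1)) / (1 - x 0 ^ (k₁ * m₁) * x 1 ^ (k₂ * m₂)))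
      N'.domain) :
    of N - of N' ∈ relations := by
  -- `hc`, `hk₁`, `hk₂` are not needed (both representations are given); record and drop them
  have _ : IsAlgebraic ℚ c := hc
  have _ : 0 < k₁ := hk₁
  have _ : 0 < k₂ := hk₂
  clear hc hk₁ hk₂
  obtain ⟨Φ, Φ', hΦ, hsa, hderiv, hinj, himage, hdet⟩ :=
    lk_exists_coordPowChart ![m₁, m₂] (Fin.forall_fin_two.mpr ⟨hm₁.ne', hm₂.ne'⟩)
  have himage' : N.domain = Φ '' N'.domain := by rw [hN'd, himage, hNd]
  have hsa' : IsSemialgebraicMapOn ℚ N'.domain Φ := by rw [hN'd]; exact hsa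
  have hinj' : InjOn Φ N'.domain := by rw [hN'd]; exact hinj
  -- the raw rule-(2) witness: source the pull-back `N'`, image `N`
  have h : of N' - of N ∈ relations := by
    refine changeOfVariablesRel_subset_relations
      ⟨2, N', N, Φ, Φ', hsa', fun x _ => (hderiv x).hasFDerivWithinAt, hinj', himage',
        fun x hx => ?_, rfl⟩
    -- the pull-back identity on `N'.domain`, Jacobian `|det DΦ| = m₁ x₀^{m₁-1} · m₂ x₁^{m₂-1}`
    have hΦx : Φ x ∈ N.domain := himage' ▸ mem_image_of_mem _ hx
    have hx' : x ∈ {x : Fin 2 → ℝ | ∀ i, x i ∈ Set.Ioo (0:ℝ) 1} := hN'd ▸ hx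
    rw [hN'i hx, hNi hΦx, hdet x hx']
    simp only [hΦ, Fin.prod_univ_two, Matrix.cons_val_zero, Matrix.cons_val_one]
    exact lk_pow_pullback c a b hm₁ hm₂ k₁ k₂ (x 0) (x 1)
  simpa only [neg_sub] using relations.neg_mem h

end Summit.KontsevichZagierPeriods.HurwitzMicroSectors.NormalFormPrinciple.PiBox.LevelK
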